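import Literature.Computability.AlgebraicComplexity.MatMulM22RankLowerBound
import Mathlib.LinearAlgebra.Dual.Lemmas
import Mathlib.LinearAlgebra.Dimension.OrzechProperty
import Mathlib.LinearAlgebra.FiniteDimensional.Lemmas
import HarnessLib

/-!
# Alekseev's lower bound `R(⟨m,2,2⟩) ≥ 3m + 2` (`m ≥ 3`) over every field — the proof

Topic `Literature/Computability/AlgebraicComplexity` (bilinear complexity; small formats). Sibling
proof file of `MatMulM22RankLowerBound.lean`: it DISCHARGES the named fact
`alekseev2015_rank_matMulTensor_m22_ge` (**Alekseev 2015, Theorem 1**: for every field `k` and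
every `m ≥ 3`, `3m + 2 ≤ R(⟨m,2,2⟩)`) as `alekseev2015_rank_matMulTensor_m22_ge_holds`,
sorry-free, following the printed proof (V. B. Alekseev, Chebyshevskiĭ Sb. 16 (4) (2015) 11–27,
§2 (Lemmas 1–4) and §3 (Lemmas 5–12)).

## The printed proof and this formalisation

Alekseev (§2, Lemma 1, from Alekseev–Smirnov 2013) reformulates a bilinear algorithm of length
`d` for `⟨m,2,2⟩` as "Problem `P`": rank-one `2m × 4` matrices `D_1, …, D_d` whose span contains
the `2m` matrices `P_{i1} = |P_i|0|`, `P_{i2} = |0|P_i|`.  For a bilinear computation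
`xy = ∑_t f_t(x) g_t(y) w_t` (`x ∈ k^{m×2}`, `y ∈ k^{2×2}`; the tree's `BilinComp (mulBilin k m 2 2)`)
this dictionary reads: `D_t = f_t ⊗ g_t`, the two width-2 blocks of `D_t` are
`D_t^1 = f_t ⊗ p_t`, `D_t^2 = f_t ⊗ q_t` with `p_t, q_t ∈ k²` the restrictions of `g_t` to the
first and to the second column of `y` (`Alekseev2015.D1`, `Alekseev2015.D2`, as linear maps
`k^{m×2} → k²`), `P_i` is the row extraction `x ↦ x_i` (`Alekseev2015.rowMap`), and the defining
property of Problem `P` is the system (1) of the source (`Alekseev2015.E1`–`E4`, obtained by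
substituting the matrix units of `k^{2×2}` for `y`).  The "parameters `(l, d − l)`" are
`l = |I|` for a maximal linearly independent subfamily `(D_t^1)_{t ∈ I}` (`Alekseev2015.Frame`),
`N_t`, `t ∉ I`, are the matrices (3) of the source (`Alekseev2015.Frame.N2`).

* Lemma 5 = `Frame.sum_D2_eq_sum_N2` / `Frame.rowMap_eq_sum_N2`; Lemma 6 = `Frame.two_mul_le_card`
  (`l ≥ 2m`) and the column count `Frame.colCount` (`2m ≤ s + 2(d − l − s)`, `s` = number of
  `N_t` of rank `≤ 1`, which is the counting step used in Lemmas 6, 7, 11, 12);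
* Lemmas 8–11 and Lemma 7 = `Frame.stepD` (no solution with `l = 2m`);
* Lemma 12 = `card_ge` via `D1_ne_zero` (no solution with `l = 2m + 1`), using the column change
  of Lemma 4 (the tree's `BilinComp.sandwich` with `y ↦ y v'`).

ONE DEVIATION, which is what makes a single argument cover every `m ≥ 3`: the source proves
Lemma 7 in the stronger form "no solution with parameters `(2m, m+2)`" ("для использования в
будущем", for later use in §4), which needs `m ≥ 5` (Lemma 11: `m + 4 ≥ 2m`), and then takes the
cases `m = 3, 4` of Theorem 1 from Alekseyev 1985 and Alekseev–Smirnov 2013.  Theorem 1 itself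
only needs the parameters `(2m, m+1)` (p. 18: "достаточно доказать, что задача `P` при `m ≥ 3` не
имеет решений с параметрами `(2m, m)`, `(2m, m+1)`, `(2m+1, m)`"), and for `(2m, m+1)` the printed
argument goes through verbatim for all `m ≥ 3`: Lemma 11 becomes the dimension count
"`m` independent matrices inside the span of `m − 1`", the count of rank-one `N_t` gives `s ≤ 2`,
and the final step needs `m − s ≥ 1`.  Lemma 12 uses Lemma 7 only for `(2m, m+1)`.  So the proof
below is Alekseev's, run at `(2m, m+1)`, and proves Theorem 1 for every `m ≥ 3` directly.

Everything is coordinate-free on the `x`-side: instead of the row operations `D_t ↦ C D_t` of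
Lemma 2 we use the basis of `k^{m×2}` dual to `(f_t)_{t ∈ I}` (Lemma 8 then says that these dual
basis matrices have rank one, `x_j = u_j ⊗ p_j`), and instead of the block operations of Lemma 3
we work inside the span of the `P_i`.

## References

* V. B. Alekseev, *O bilineinoi slozhnosti umnozheniya matrits razmerov `m × 2` i `2 × 2`*,
  Chebyshevskiĭ Sb. 16 (4) (2015) 11–27: §2 Lemmas 1–4 (pp. 15–16), §3 Thm 1, Lemmas 5–12
  (pp. 16–24). [Alekseev2015ChebyshevM22]
* V. B. Alekseev, A. V. Smirnov, Sovrem. Probl. Mat. 17 (2013) 135–152 (Lemmas 1–4).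
  [AlekseevSmirnov2013]
-/

namespace Literature.Computability.AlgebraicComplexity

open Module Matrix

namespace Alekseev2015

variable {k : Type*} [Field k] {m : ℕ} {ι : Type*} [Fintype ι]

/-- The space of `2m × 2` blocks, realised as linear maps `k^{m×2} → k²` (a block `f ⊗ p` is
`x ↦ f(x) p`; the matrix `P_i` of the source is the row extraction `x ↦ x_i`).
[cite: Alekseev2015ChebyshevM22, §2 (Problem P)] -/
abbrev Blk (k : Type*) [Field k] (m : ℕ) := Matrix (Fin m) (Fin 2) k →ₗ[k] (Fin 2 → k)

/-- `P_i`: the row extraction `x ↦ x_i`. [cite: Alekseev2015ChebyshevM22, §2 (the matrices `P_{i1}, P_{i2}`)] -/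
def rowMap (k : Type*) [Field k] (m : ℕ) (i : Fin m) : Blk k m where
  toFun x := fun c => x i c
  map_add' x y := by funext c; simp
  map_smul' a x := by funext c; simp

/-- `rowMap i x c = x i c`. [cite: Alekseev2015ChebyshevM22, §2] -/
@[simp] theorem rowMap_apply (i : Fin m) (x : Matrix (Fin m) (Fin 2) k) (c : Fin 2) :
    rowMap k m i x c = x i c := rfl

/-- The `c`-th column of a block, a linear form on `k^{m×2}`. [cite: Alekseev2015ChebyshevM22, §3 (columns of the `D_t`)] -/
def col (c : Fin 2) : Blk k m →ₗ[k] Module.Dual k (Matrix (Fin m) (Fin 2) k) where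
  toFun N := (LinearMap.proj c).comp N
  map_add' N N' := by ext x; simp
  map_smul' a N := by ext x; simp

/-- `col c N x = N x c`. [cite: Alekseev2015ChebyshevM22, §3] -/
@[simp] theorem col_apply (c : Fin 2) (N : Blk k m) (x : Matrix (Fin m) (Fin 2) k) :
    col c N x = N x c := rfl

/-- A block of rank at most one: `N = ψ ⊗ δ`. [cite: Alekseev2015ChebyshevM22, §3 (matrices of rank 1)] -/
def RankLEOne (N : Blk k m) : Prop :=
  ∃ (ψ : Module.Dual k (Matrix (Fin m) (Fin 2) k)) (δ : Fin 2 → k), ∀ x, N x = ψ x • δ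

/-- `f ⊗ v` has rank at most one. [cite: Alekseev2015ChebyshevM22, §3] -/
theorem rankLEOne_smulRight (f : Module.Dual k (Matrix (Fin m) (Fin 2) k)) (v : Fin 2 → k) :
    RankLEOne (f.smulRight v) :=
  ⟨f, v, fun x => by simp⟩

/-- A block all of whose values lie on one line has rank at most one.
[cite: Alekseev2015ChebyshevM22, §3] -/
theorem rankLEOne_of_forall_mem_span (N : Blk k m) (δ : Fin 2 → k)
    (h : ∀ x, N x ∈ Submodule.span k ({δ} : Set (Fin 2 → k))) : RankLEOne N := by
  by_cases hδ : δ = 0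
  · refine ⟨0, 0, fun x => ?_⟩
    have hx := h x
    rw [hδ, Submodule.span_zero_singleton, Submodule.mem_bot] at hx
    simp [hx]
  · obtain ⟨c0, hc0⟩ : ∃ c0, δ c0 ≠ 0 := Function.ne_iff.mp hδ
    refine ⟨(δ c0)⁻¹ • col c0 N, δ, fun x => ?_⟩
    obtain ⟨a, ha⟩ := Submodule.mem_span_singleton.1 (h x)
    have hac : a = (δ c0)⁻¹ * N x c0 := by
      have := congrFun ha c0
      simp only [Pi.smul_apply, smul_eq_mul] at this
      exact (eq_inv_mul_iff_mul_eq₀ hc0).mpr (by rw [mul_comm]; exact this)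
    rw [← ha]
    simp only [LinearMap.smul_apply, col_apply, smul_eq_mul]
    rw [hac]

/-- The columns of a rank-one block are multiples of one form. [cite: Alekseev2015ChebyshevM22, §3] -/
theorem col_eq_smul_of_rankLEOne {N : Blk k m} {ψ : Module.Dual k (Matrix (Fin m) (Fin 2) k)}
    {δ : Fin 2 → k} (h : ∀ x, N x = ψ x • δ) (c : Fin 2) : col c N = δ c • ψ := by
  ext x
  simp [h x, mul_comm]

section Computation

variable (β : BilinComp (mulBilin k m 2 2) ι)

/-- `p_t ∈ k²`: the form `g_t` on the first column of `y` (`p_t j = g_t(E_{j1})`).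
[cite: Alekseev2015ChebyshevM22, §3 (the vectors `p_j`)] -/
def pvec (t : ι) : Fin 2 → k := fun j => β.g t (Matrix.single j 0 1)

/-- `q_t ∈ k²`: the form `g_t` on the second column of `y`. [cite: Alekseev2015ChebyshevM22, §3 (the vectors `q_j`)] -/
def qvec (t : ι) : Fin 2 → k := fun j => β.g t (Matrix.single j 1 1)

/-- The first block `D_t^1 = f_t ⊗ p_t`. [cite: Alekseev2015ChebyshevM22, §3 (1)] -/
def D1 (t : ι) : Blk k m := (β.f t).smulRight (pvec β t)

/-- The second block `D_t^2 = f_t ⊗ q_t`. [cite: Alekseev2015ChebyshevM22, §3 (1)] -/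
def D2 (t : ι) : Blk k m := (β.f t).smulRight (qvec β t)

/-- `D_t^1(x) = f_t(x) p_t`. [cite: Alekseev2015ChebyshevM22, §3 (1)] -/
@[simp] theorem D1_apply (t : ι) (x : Matrix (Fin m) (Fin 2) k) : D1 β t x = β.f t x • pvec β t := rfl

/-- `D_t^2(x) = f_t(x) q_t`. [cite: Alekseev2015ChebyshevM22, §3 (1)] -/
@[simp] theorem D2_apply (t : ι) (x : Matrix (Fin m) (Fin 2) k) : D2 β t x = β.f t x • qvec β t := rfl

/-- The computation evaluated at a matrix unit `y = E_{j₀ l}`: entry `(i, c)` of `x E_{j₀ l}`.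
[cite: Alekseev2015ChebyshevM22, §3 (1)] -/
theorem entry_eq (x : Matrix (Fin m) (Fin 2) k) (j0 l : Fin 2) (i : Fin m) (c : Fin 2) :
    (x * Matrix.single j0 l (1 : k)) i c = ∑ t, β.f t x * β.g t (Matrix.single j0 l 1) * β.w t i c := by
  have h := β.map_eq_sum x (Matrix.single j0 l 1)
  rw [mulBilin_apply] at h
  have := congrFun (congrFun h i) c
  rw [this]
  simp only [Matrix.sum_apply, Matrix.smul_apply, smul_eq_mul]

/-- **(1), first equation**: `∑_t α¹_{it} D_t^1 = P_i`. [cite: Alekseev2015ChebyshevM22, §3 (1)] -/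
theorem E1 (i : Fin m) : ∑ t, β.w t i 0 • D1 β t = rowMap k m i := by
  apply LinearMap.ext
  intro x
  funext c
  have h := entry_eq β x c 0 i 0
  rw [Matrix.mul_single_apply_same, mul_one] at h
  simp only [LinearMap.coe_sum, Finset.sum_apply, LinearMap.smul_apply, D1_apply,
    Pi.smul_apply, smul_eq_mul, rowMap_apply, pvec]
  rw [h]
  exact Finset.sum_congr rfl fun t _ => by ring

/-- **(1), second equation**: `∑_t α¹_{it} D_t^2 = 0`. [cite: Alekseev2015ChebyshevM22, §3 (1)] -/
theorem E2 (i : Fin m) : ∑ t, β.w t i 0 • D2 β t = 0 := by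
  apply LinearMap.ext
  intro x
  funext c
  have h := entry_eq β x c 1 i 0
  rw [Matrix.mul_single_apply_of_ne (1 : k) c 1 i 0 (by decide)] at h
  simp only [LinearMap.coe_sum, Finset.sum_apply, LinearMap.smul_apply, D2_apply,
    Pi.smul_apply, smul_eq_mul, LinearMap.zero_apply, Pi.zero_apply, qvec]
  rw [h]
  exact Finset.sum_congr rfl fun t _ => by ring

/-- **(1), third equation**: `∑_t α²_{it} D_t^1 = 0`. [cite: Alekseev2015ChebyshevM22, §3 (1)] -/
theorem E3 (i : Fin m) : ∑ t, β.w t i 1 • D1 β t = 0 := by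
  apply LinearMap.ext
  intro x
  funext c
  have h := entry_eq β x c 0 i 1
  rw [Matrix.mul_single_apply_of_ne (1 : k) c 0 i 1 (by decide)] at h
  simp only [LinearMap.coe_sum, Finset.sum_apply, LinearMap.smul_apply, D1_apply,
    Pi.smul_apply, smul_eq_mul, LinearMap.zero_apply, Pi.zero_apply, pvec]
  rw [h]
  exact Finset.sum_congr rfl fun t _ => by ring

/-- **(1), fourth equation**: `∑_t α²_{it} D_t^2 = P_i`. [cite: Alekseev2015ChebyshevM22, §3 (1)] -/
theorem E4 (i : Fin m) : ∑ t, β.w t i 1 • D2 β t = rowMap k m i := by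
  apply LinearMap.ext
  intro x
  funext c
  have h := entry_eq β x c 1 i 1
  rw [Matrix.mul_single_apply_same, mul_one] at h
  simp only [LinearMap.coe_sum, Finset.sum_apply, LinearMap.smul_apply, D2_apply,
    Pi.smul_apply, smul_eq_mul, rowMap_apply, qvec]
  rw [h]
  exact Finset.sum_congr rfl fun t _ => by ring

/-- The coordinate forms `x ↦ x_{ic}` span the dual of `k^{m×2}`. [folklore] -/
private theorem dual_eq_sum_coord (φ : Module.Dual k (Matrix (Fin m) (Fin 2) k)) :
    φ = ∑ i, ∑ c, φ (Matrix.single i c 1) • col c (rowMap k m i) := by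
  ext x
  conv_lhs => rw [Matrix.matrix_eq_sum_single x]
  simp only [map_sum, LinearMap.coe_sum, Finset.sum_apply, LinearMap.smul_apply, col_apply,
    rowMap_apply, smul_eq_mul]
  refine Finset.sum_congr rfl fun i _ => Finset.sum_congr rfl fun c _ => ?_
  rw [show Matrix.single i c (x i c) = x i c • Matrix.single i c (1 : k) by
    rw [Matrix.smul_single, smul_eq_mul, mul_one], map_smul, smul_eq_mul, mul_comm]

/-- `finrank (k^{m×2})* = 2m`. [folklore] -/
private theorem finrank_dual : finrank k (Module.Dual k (Matrix (Fin m) (Fin 2) k)) = 2 * m := by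
  rw [Subspace.dual_finrank_eq, Module.finrank_matrix]
  simp [mul_comm]

/-- The `P_i` are linearly independent. [cite: Alekseev2015ChebyshevM22, §3 (proof of Lemma 6)] -/
theorem linearIndependent_rowMap : LinearIndependent k (rowMap k m) := by
  rw [Fintype.linearIndependent_iff]
  intro c hc i
  have h := congrFun (LinearMap.congr_fun hc (Matrix.single i 0 (1 : k))) 0
  simp only [LinearMap.coe_sum, Finset.sum_apply, LinearMap.smul_apply, Pi.smul_apply,
    rowMap_apply, smul_eq_mul, LinearMap.zero_apply, Pi.zero_apply] at h
  rw [Finset.sum_eq_single i (fun j _ hj => by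
      rw [Matrix.single_apply_of_row_ne (Ne.symm hj), mul_zero]) (by simp)] at h
  simpa using h

end Computation

/-! ## The frame: a maximal independent subfamily of the first blocks (the parameters `(l, d−l)`) -/

/-- A maximal linearly independent subfamily `(D_t^1)_{t ∈ I}` together with coefficients
expressing the other first blocks in it ((2) of the source: `D_t^1 = ∑_p b_t^p D_p^1`, `t ∉ I`);
`l = |I|`. [cite: Alekseev2015ChebyshevM22, §3 (2)] -/
structure Frame (β : BilinComp (mulBilin k m 2 2) ι) where
  /-- the independent indices (`1, …, l` in the source) -/
  I : Finset ι
  /-- the coefficients `b_t^p` -/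
  b : ι → ι → k
  /-- independence of `(D_t^1)_{t ∈ I}` -/
  indep : ∀ c : ι → k, ∑ p ∈ I, c p • D1 β p = 0 → ∀ p ∈ I, c p = 0
  /-- (2): the other first blocks are combinations -/
  D1_eq : ∀ t, t ∉ I → D1 β t = ∑ p ∈ I, b t p • D1 β p

/-- Every computation has a frame. [cite: Alekseev2015ChebyshevM22, §3 (2)] -/
theorem exists_frame (β : BilinComp (mulBilin k m 2 2) ι) : Nonempty (Frame β) := by
  classical
  obtain ⟨s, hli, hmax⟩ := exists_maximal_linearIndepOn k (D1 β)
  let I : Finset ι := s.toFinset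
  have hIs : (I : Set ι) = s := by simp [I]
  have hmem : ∀ t, t ∉ I → D1 β t ∈ Submodule.span k (D1 β '' (I : Set ι)) := by
    intro t ht
    have hts : t ∉ s := by simpa [I] using ht
    obtain ⟨a, ha, hat⟩ := hmax t hts
    rw [hIs]
    have := Submodule.smul_mem _ a⁻¹ hat
    rwa [smul_smul, inv_mul_cancel₀ ha, one_smul] at this
  choose! b hb using fun t (ht : t ∉ I) =>
    (Submodule.mem_span_image_finset_iff_exists_fun' k).1 (hmem t ht)
  refine ⟨⟨I, b, ?_, ?_⟩⟩
  · intro c hc p hp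
    have h := (linearIndepOn_iff'.1 hli) I c (by rw [hIs]) hc
    exact h p hp
  · intro t ht
    exact (hb t ht).symm

namespace Frame

variable {β : BilinComp (mulBilin k m 2 2) ι} (F : Frame β)

/-- `N_t^2 = D_t^2 − ∑_p b_t^p D_p^2`, the second block of the matrix `N_t` of (3)
(its first block vanishes). [cite: Alekseev2015ChebyshevM22, §3 (3)] -/
def N2 (t : ι) : Blk k m := D2 β t - ∑ p ∈ F.I, F.b t p • D2 β p

/-- Members of the independent family are non-zero: `p_t ≠ 0`. [cite: Alekseev2015ChebyshevM22, §3 (proof of Lemma 7)] -/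
theorem pvec_ne_zero {t : ι} (ht : t ∈ F.I) : pvec β t ≠ 0 := by
  classical
  intro h0
  have h1 : D1 β t = 0 := by ext x; simp [h0]
  have := F.indep (fun p => if p = t then 1 else 0) (by simp [Finset.sum_ite_eq', ht, h1]) t ht
  simp at this

/-- Members of the independent family are non-zero: `f_t ≠ 0`. [cite: Alekseev2015ChebyshevM22, §3 (proof of Lemma 7)] -/
theorem f_ne_zero {t : ι} (ht : t ∈ F.I) : β.f t ≠ 0 := by
  classical
  intro h0
  have h1 : D1 β t = 0 := by ext x; simp [h0]
  have := F.indep (fun p => if p = t then 1 else 0) (by simp [Finset.sum_ite_eq', ht, h1]) t ht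
  simp at this

/-- If `D_t^1 = 0` (`t ∉ I`) then all `b_t^p = 0`, so `N_t^2 = D_t^2` (the source's "type F").
[cite: Alekseev2015ChebyshevM22, Lemma 10] -/
theorem N2_eq_D2_of_D1_eq_zero {t : ι} (ht : t ∉ F.I) (h0 : D1 β t = 0) : F.N2 t = D2 β t := by
  have hb : ∀ p ∈ F.I, F.b t p = 0 := F.indep (F.b t) (by rw [← F.D1_eq t ht, h0])
  rw [N2, Finset.sum_eq_zero fun p hp => by rw [hb p hp, zero_smul], sub_zero]

variable [DecidableEq ι]

/-- The complementary indices `J` (`l+1, …, d` in the source). [cite: Alekseev2015ChebyshevM22, §3] -/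
def J : Finset ι := F.Iᶜ

/-- `t ∈ J ↔ t ∉ I`. [cite: Alekseev2015ChebyshevM22, §3] -/
@[simp] theorem mem_J {t : ι} : t ∈ F.J ↔ t ∉ F.I := Finset.mem_compl

/-- `|I| + |J| = d`. [cite: Alekseev2015ChebyshevM22, §3 (the parameters `(l, d − l)`)] -/
theorem card_I_add_card_J : F.I.card + F.J.card = Fintype.card ι := by
  rw [J, Finset.card_compl]
  have := Finset.card_le_univ F.I
  omega

/-- **Lemma 5 (core).** A combination of the `D_t` whose first block vanishes is a combination of
the `N_t`, `t ∉ I`, with the same coefficients. [cite: Alekseev2015ChebyshevM22, Lemma 5] -/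
theorem sum_D2_eq_sum_N2 (c : ι → k) (hc : ∑ t, c t • D1 β t = 0) :
    ∑ t, c t • D2 β t = ∑ t ∈ F.J, c t • F.N2 t := by
  -- rewrite the relation in terms of the independent family
  have hsplit : ∑ t, c t • D1 β t =
      ∑ p ∈ F.I, (c p + ∑ t ∈ F.J, c t * F.b t p) • D1 β p := by
    rw [← Finset.sum_add_sum_compl F.I (fun t => c t • D1 β t)]
    have hJ : ∑ t ∈ F.Iᶜ, c t • D1 β t = ∑ t ∈ F.J, ∑ p ∈ F.I, (c t * F.b t p) • D1 β p := by
      refine Finset.sum_congr rfl fun t ht => ?_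
      rw [F.D1_eq t (Finset.mem_compl.1 ht), Finset.smul_sum]
      exact Finset.sum_congr rfl fun p _ => by rw [smul_smul]
    rw [hJ, Finset.sum_comm]
    rw [← Finset.sum_add_distrib]
    exact Finset.sum_congr rfl fun p _ => by rw [add_smul, Finset.sum_smul]
  rw [hsplit] at hc
  have hcoef := F.indep _ hc
  -- now compute
  have hN : ∑ t ∈ F.J, c t • F.N2 t =
      ∑ t ∈ F.J, c t • D2 β t - ∑ p ∈ F.I, (∑ t ∈ F.J, c t * F.b t p) • D2 β p := by
    simp only [N2, smul_sub, Finset.sum_sub_distrib, Finset.smul_sum, smul_smul]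
    rw [Finset.sum_comm]
    congr 1
    exact Finset.sum_congr rfl fun p _ => by rw [Finset.sum_smul]
  rw [hN, ← Finset.sum_add_sum_compl F.I (fun t => c t • D2 β t)]
  have hI : ∑ p ∈ F.I, c p • D2 β p = -∑ p ∈ F.I, (∑ t ∈ F.J, c t * F.b t p) • D2 β p := by
    rw [← Finset.sum_neg_distrib]
    refine Finset.sum_congr rfl fun p hp => ?_
    rw [eq_neg_of_add_eq_zero_left (hcoef p hp)]
    exact neg_smul (∑ t ∈ F.J, c t * F.b t p) (D2 β p)
  rw [hI, J]
  abel

/-- **Lemma 5.** `P_i = ∑_{t ∉ I} α²_{it} N_t^2`. [cite: Alekseev2015ChebyshevM22, Lemma 5 (4)] -/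
theorem rowMap_eq_sum_N2 (i : Fin m) : rowMap k m i = ∑ t ∈ F.J, β.w t i 1 • F.N2 t := by
  rw [← E4 β i]
  exact F.sum_D2_eq_sum_N2 _ (E3 β i)

/-- `P_i` lies in the span of the `N_t^2`, `t ∈ J`. [cite: Alekseev2015ChebyshevM22, Lemma 5] -/
theorem rowMap_mem_span_N2 (i : Fin m) :
    rowMap k m i ∈ Submodule.span k (F.N2 '' (F.J : Set ι)) := by
  rw [F.rowMap_eq_sum_N2 i]
  exact Submodule.sum_mem _ fun t ht =>
    Submodule.smul_mem _ _ (Submodule.subset_span ⟨t, by simpa using ht, rfl⟩)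

/-- The coefficients `κ_i^p` with `P_i = ∑_{p ∈ I} κ_i^p D_p^1` (the `k_i^t` of (2)).
[cite: Alekseev2015ChebyshevM22, §3 (2)] -/
def κ (i : Fin m) (p : ι) : k := β.w p i 0 + ∑ t ∈ F.J, β.w t i 0 * F.b t p

/-- **(2), second equation**: `P_i = ∑_{p ∈ I} κ_i^p D_p^1`. [cite: Alekseev2015ChebyshevM22, §3 (2)] -/
theorem rowMap_eq_sum_κ (i : Fin m) : rowMap k m i = ∑ p ∈ F.I, F.κ i p • D1 β p := by
  rw [← E1 β i, ← Finset.sum_add_sum_compl F.I (fun t => β.w t i 0 • D1 β t)]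
  have hJ : ∑ t ∈ F.Iᶜ, β.w t i 0 • D1 β t = ∑ p ∈ F.I, (∑ t ∈ F.J, β.w t i 0 * F.b t p) • D1 β p := by
    have : ∑ t ∈ F.Iᶜ, β.w t i 0 • D1 β t = ∑ t ∈ F.J, ∑ p ∈ F.I, (β.w t i 0 * F.b t p) • D1 β p := by
      refine Finset.sum_congr rfl fun t ht => ?_
      rw [F.D1_eq t (Finset.mem_compl.1 ht), Finset.smul_sum]
      exact Finset.sum_congr rfl fun p _ => by rw [smul_smul]
    rw [this, Finset.sum_comm]
    exact Finset.sum_congr rfl fun p _ => by rw [Finset.sum_smul]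
  rw [hJ, ← Finset.sum_add_distrib]
  exact Finset.sum_congr rfl fun p _ => by rw [κ, add_smul]

/-- The coordinate forms lie in the span of `(f_t)_{t ∈ I}`. [cite: Alekseev2015ChebyshevM22, Lemma 6 (proof)] -/
theorem coord_mem_span_f (i : Fin m) (c : Fin 2) :
    col c (rowMap k m i) ∈ Submodule.span k (β.f '' (F.I : Set ι)) := by
  rw [F.rowMap_eq_sum_κ i, map_sum]
  refine Submodule.sum_mem _ fun p hp => ?_
  rw [map_smul]
  refine Submodule.smul_mem _ _ ?_
  have : col c (D1 β p) = pvec β p c • β.f p := by ext x; simp [mul_comm]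
  rw [this]
  exact Submodule.smul_mem _ _ (Submodule.subset_span ⟨p, by simpa using hp, rfl⟩)

/-- The `f_t`, `t ∈ I`, span the dual space. [cite: Alekseev2015ChebyshevM22, Lemma 6 (proof)] -/
theorem span_f_eq_top : Submodule.span k (β.f '' (F.I : Set ι)) = ⊤ := by
  rw [eq_top_iff]
  intro φ _
  rw [dual_eq_sum_coord φ]
  exact Submodule.sum_mem _ fun i _ => Submodule.sum_mem _ fun c _ =>
    Submodule.smul_mem _ _ (F.coord_mem_span_f i c)

/-- **Lemma 6, first half**: `l ≥ 2m`. [cite: Alekseev2015ChebyshevM22, Lemma 6] -/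
theorem two_mul_le_card : 2 * m ≤ F.I.card := by
  classical
  have h1 : finrank k (Module.Dual k (Matrix (Fin m) (Fin 2) k)) ≤
      finrank k (Submodule.span k
        (↑(F.I.image β.f) : Set (Module.Dual k (Matrix (Fin m) (Fin 2) k)))) := by
    rw [← finrank_top k (Module.Dual k (Matrix (Fin m) (Fin 2) k))]
    apply Submodule.finrank_mono
    rw [Finset.coe_image, F.span_f_eq_top]
  have h2 := finrank_span_finset_le_card (R := k) (F.I.image β.f)
  have h3 := Finset.card_image_le (s := F.I) (f := β.f)
  rw [finrank_dual] at h1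
  exact h1.trans ((h2.trans h3))

/-- The rank-one indices among `J` (the `s` rank-one matrices `N_t` of the source).
[cite: Alekseev2015ChebyshevM22, Lemma 7 (proof), Lemma 12 (proof)] -/
noncomputable def R1 : Finset ι := by
  classical exact F.J.filter fun t => RankLEOne (F.N2 t)

/-- Membership in `R1`. [cite: Alekseev2015ChebyshevM22, Lemma 7 (proof)] -/
theorem mem_R1 {t : ι} : t ∈ F.R1 ↔ t ∈ F.J ∧ RankLEOne (F.N2 t) := by
  classical
  simp [R1]

/-- `R1 ⊆ J`. [cite: Alekseev2015ChebyshevM22, Lemma 7 (proof)] -/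
theorem R1_subset : F.R1 ⊆ F.J := fun _ ht => (F.mem_R1.1 ht).1

/-- **The column count** (Lemmas 6, 7, 11, 12): the columns of the `N_t^2`, `t ∈ J`, span the
`2m`-dimensional dual space, and a rank-one `N_t^2` contributes one column:
`2m ≤ s + 2(|J| − s)`. [cite: Alekseev2015ChebyshevM22, Lemma 6 and proof of Lemma 7] -/
theorem colCount : 2 * m ≤ F.R1.card + 2 * (F.J \ F.R1).card := by
  classical
  -- choose the rank-one decompositions
  have hch : ∀ t ∈ F.R1, ∃ ψδ : Module.Dual k (Matrix (Fin m) (Fin 2) k) × (Fin 2 → k),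
      ∀ x, F.N2 t x = ψδ.1 x • ψδ.2 := fun t ht => by
    obtain ⟨ψ, δ, h⟩ := (F.mem_R1.1 ht).2
    exact ⟨(ψ, δ), h⟩
  choose! ψδ hψδ using hch
  let T : Finset (Module.Dual k (Matrix (Fin m) (Fin 2) k)) :=
    F.R1.image (fun t => (ψδ t).1) ∪
      ((F.J \ F.R1) ×ˢ (Finset.univ : Finset (Fin 2))).image (fun tc => col tc.2 (F.N2 tc.1))
  have hcolN : ∀ t ∈ F.J, ∀ c, col c (F.N2 t) ∈ Submodule.span k (↑T : Set (Module.Dual k (Matrix (Fin m) (Fin 2) k))) := by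
    intro t ht c
    by_cases hR : t ∈ F.R1
    · rw [col_eq_smul_of_rankLEOne (hψδ t hR) c]
      refine Submodule.smul_mem _ _ (Submodule.subset_span ?_)
      simp only [T, Finset.coe_union, Finset.coe_image, Set.mem_union, Set.mem_image,
        Finset.mem_coe]
      exact Or.inl ⟨t, hR, rfl⟩
    · refine Submodule.subset_span ?_
      simp only [T, Finset.coe_union, Finset.coe_image, Set.mem_union, Set.mem_image,
        Finset.mem_coe, Finset.mem_product, Finset.mem_univ, and_true, Finset.mem_sdiff]
      exact Or.inr ⟨(t, c), ⟨ht, hR⟩, rfl⟩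
  have hcoord : ∀ i c, col c (rowMap k m i) ∈ Submodule.span k (↑T : Set (Module.Dual k (Matrix (Fin m) (Fin 2) k))) := by
    intro i c
    rw [F.rowMap_eq_sum_N2 i, map_sum]
    refine Submodule.sum_mem _ fun t ht => ?_
    rw [map_smul]
    exact Submodule.smul_mem _ _ (hcolN t ht c)
  have htop : (⊤ : Submodule k (Module.Dual k (Matrix (Fin m) (Fin 2) k))) ≤
      Submodule.span k (↑T : Set (Module.Dual k (Matrix (Fin m) (Fin 2) k))) := by
    intro φ _
    rw [dual_eq_sum_coord φ]
    exact Submodule.sum_mem _ fun i _ => Submodule.sum_mem _ fun c _ =>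
      Submodule.smul_mem _ _ (hcoord i c)
  have h1 : 2 * m ≤ finrank k (Submodule.span k (↑T : Set (Module.Dual k (Matrix (Fin m) (Fin 2) k)))) := by
    rw [← finrank_dual (k := k) (m := m), ← finrank_top k (Module.Dual k (Matrix (Fin m) (Fin 2) k))]
    exact Submodule.finrank_mono htop
  have h2 := finrank_span_finset_le_card (R := k) T
  have h3 : T.card ≤ F.R1.card + 2 * (F.J \ F.R1).card := by
    refine (Finset.card_union_le _ _).trans (Nat.add_le_add Finset.card_image_le ?_)
    refine Finset.card_image_le.trans ?_
    rw [Finset.card_product, Finset.card_univ, Fintype.card_fin, mul_comm]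
  exact h1.trans (h2.trans h3)

/-- **Lemma 6, second half**: `d − l ≥ m`. [cite: Alekseev2015ChebyshevM22, Lemma 6] -/
theorem le_card_J : m ≤ F.J.card := by
  have h := F.colCount
  have h1 : F.R1.card + 2 * (F.J \ F.R1).card ≤ 2 * F.J.card := by
    have := Finset.card_sdiff_add_card_eq_card F.R1_subset
    omega
  omega


/-! ## The case `l = 2m` (Lemmas 7–11): the dual basis `x_j` and the classes of rows -/

section StepD

variable (hI : F.I.card = 2 * m)

/-- The forms `(f_t)_{t ∈ I}` as a family on the subtype. [cite: Alekseev2015ChebyshevM22, Lemma 7 (proof)] -/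
def fI : ↥F.I → Module.Dual k (Matrix (Fin m) (Fin 2) k) := fun t => β.f t

omit [DecidableEq ι] in
/-- `fI t = f_t`. [cite: Alekseev2015ChebyshevM22, Lemma 7 (proof)] -/
@[simp] theorem fI_apply (t : ↥F.I) : F.fI t = β.f t := rfl

omit [DecidableEq ι] in
/-- The range of `fI` is `f(I)`. [folklore] -/
private theorem range_fI : Set.range F.fI = β.f '' (F.I : Set ι) := by
  ext φ
  simp only [Set.mem_range, Set.mem_image, Finset.mem_coe, fI, Subtype.exists, exists_prop]

include hI in
/-- When `l = 2m` the `f_t`, `t ∈ I`, are linearly independent (they span the `2m`-dimensional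
dual space; "все матрицы `D_1^1, …, D_l^1` должны быть ненулевыми и построенными на `2m` линейно
независимых столбцах"). [cite: Alekseev2015ChebyshevM22, Lemma 7 (proof)] -/
theorem linearIndependent_fI : LinearIndependent k F.fI := by
  apply linearIndependent_of_top_le_span_of_card_eq_finrank
  · rw [range_fI, F.span_f_eq_top]
  · rw [Fintype.card_coe, hI, finrank_dual]

/-- When `l = 2m`: the basis `(f_t)_{t ∈ I}` of the dual space.
[cite: Alekseev2015ChebyshevM22, Lemma 7 (proof)] -/
noncomputable def basisF : Basis ↥F.I k (Module.Dual k (Matrix (Fin m) (Fin 2) k)) :=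
  Basis.mk (F.linearIndependent_fI hI) (by rw [range_fI, F.span_f_eq_top])

/-- `basisF t = f_t`. [cite: Alekseev2015ChebyshevM22, Lemma 7 (proof)] -/
@[simp] theorem basisF_apply (t : ↥F.I) : F.basisF hI t = β.f t := by
  simp [basisF]

/-- The dual basis matrices `x_j ∈ k^{m×2}`, `j ∈ I` (`f_t(x_j) = δ_{tj}`): these replace the
row operations `D_t ↦ C D_t` of Lemma 2 / the normal form of p. 19.
[cite: Alekseev2015ChebyshevM22, Lemma 7 (proof, the matrix `C`)] -/
noncomputable def xd (j : ↥F.I) : Matrix (Fin m) (Fin 2) k :=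
  (Module.evalEquiv k (Matrix (Fin m) (Fin 2) k)).symm ((F.basisF hI).dualBasis j)

/-- `f_t(x_j) = δ_{tj}`. [cite: Alekseev2015ChebyshevM22, Lemma 7 (proof)] -/
theorem f_xd (t j : ↥F.I) : β.f t (F.xd hI j) = if t = j then 1 else 0 := by
  rw [xd, Module.apply_evalEquiv_symm_apply, ← F.basisF_apply hI t, Basis.dualBasis_apply_self]

/-- Expansion in the dual basis: `x = ∑_j f_j(x) x_j`. [folklore] -/
private theorem expand (x : Matrix (Fin m) (Fin 2) k) : x = ∑ j : ↥F.I, β.f j x • F.xd hI j := by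
  rw [← sub_eq_zero, ← Module.forall_dual_apply_eq_zero_iff k]
  intro φ
  rw [← (F.basisF hI).sum_repr φ]
  simp only [LinearMap.coe_sum, Finset.sum_apply]
  refine Finset.sum_eq_zero fun t _ => ?_
  rw [LinearMap.smul_apply, basisF_apply, map_sub, map_sum]
  simp only [map_smul, f_xd, smul_eq_mul, mul_ite, mul_one, mul_zero, Finset.sum_ite_eq,
    Finset.mem_univ, if_true, sub_self]

/-- A linear map is determined on the dual basis: values in a subspace.
[folklore] -/
private theorem map_mem_of_xd_mem (N : Blk k m) (P : Submodule k (Fin 2 → k))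
    (h : ∀ j : ↥F.I, N (F.xd hI j) ∈ P) (x : Matrix (Fin m) (Fin 2) k) : N x ∈ P := by
  rw [F.expand hI x, map_sum]
  exact Submodule.sum_mem _ fun j _ => by rw [map_smul]; exact Submodule.smul_mem _ _ (h j)

/-- **Lemma 8**: row `i` of `x_j` is `κ_i^j p_j` — the dual basis matrices have rank one,
`x_j = u_j ⊗ p_j`. [cite: Alekseev2015ChebyshevM22, Lemma 8] -/
theorem xd_entry (j : ↥F.I) (i : Fin m) (c : Fin 2) :
    F.xd hI j i c = F.κ i j * pvec β j c := by
  have h := LinearMap.congr_fun (F.rowMap_eq_sum_κ i) (F.xd hI j)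
  have h' := congrFun h c
  simp only [rowMap_apply, LinearMap.coe_sum, Finset.sum_apply, LinearMap.smul_apply, D1_apply,
    Pi.smul_apply, smul_eq_mul] at h'
  rw [h', ← Finset.sum_coe_sort F.I]
  rw [Finset.sum_eq_single j]
  · rw [F.f_xd hI j j, if_pos rfl, one_mul]
  · intro p _ hp
    rw [F.f_xd hI p j, if_neg hp, zero_mul, mul_zero]
  · simp

/-- A combination `Q = ∑ c_i P_i` evaluated at `x_j`: `Q(x_j) = (∑_i c_i κ_i^j) p_j`.
[cite: Alekseev2015ChebyshevM22, Lemma 9 (proof)] -/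
theorem sum_rowMap_xd (c : Fin m → k) (j : ↥F.I) :
    (∑ i, c i • rowMap k m i) (F.xd hI j) = (∑ i, c i * F.κ i j) • pvec β j := by
  funext c'
  simp only [LinearMap.coe_sum, Finset.sum_apply, LinearMap.smul_apply, rowMap_apply,
    Pi.smul_apply, smul_eq_mul, F.xd_entry hI, Finset.sum_mul, mul_assoc]

/-- (2) at `x_j` for `t ∉ I`: `f_t(x_j) p_t = b_t^j p_j`. [cite: Alekseev2015ChebyshevM22, Lemma 10 (proof)] -/
theorem f_xd_smul_pvec {t : ι} (ht : t ∉ F.I) (j : ↥F.I) :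
    β.f t (F.xd hI j) • pvec β t = F.b t j • pvec β j := by
  have h := LinearMap.congr_fun (F.D1_eq t ht) (F.xd hI j)
  simp only [D1_apply, LinearMap.coe_sum, Finset.sum_apply, LinearMap.smul_apply] at h
  rw [h, ← Finset.sum_coe_sort F.I, Finset.sum_eq_single j]
  · rw [F.f_xd hI j j, if_pos rfl, one_smul]
  · intro p _ hp
    rw [F.f_xd hI p j, if_neg hp, zero_smul, smul_zero]
  · simp

/-- `N_t^2(x_j) = f_t(x_j) q_t − b_t^j q_j` for `t ∉ I`. [cite: Alekseev2015ChebyshevM22, Lemma 10 (proof)] -/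
theorem N2_xd (t : ι) (j : ↥F.I) :
    F.N2 t (F.xd hI j) = β.f t (F.xd hI j) • qvec β t - F.b t j • qvec β j := by
  have hsum : (∑ p ∈ F.I, F.b t p • D2 β p) (F.xd hI j) = F.b t j • qvec β j := by
    simp only [LinearMap.coe_sum, Finset.sum_apply, LinearMap.smul_apply, D2_apply]
    rw [← Finset.sum_coe_sort F.I, Finset.sum_eq_single j]
    · rw [F.f_xd hI j j, if_pos rfl, one_smul]
    · intro p _ hp
      rw [F.f_xd hI p j, if_neg hp, zero_smul, smul_zero]
    · simp
  have : F.N2 t = D2 β t - ∑ p ∈ F.I, F.b t p • D2 β p := rfl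
  rw [this, LinearMap.sub_apply, hsum, D2_apply]

/-- **Lemma 10** (type G matrices live on one class of rows): for `t ∉ I` with `p_t ≠ 0`, if
`N_t^2(x_j) ≠ 0` then `p_j` is proportional to `p_t`. [cite: Alekseev2015ChebyshevM22, Lemma 10] -/
theorem par_of_N2_xd_ne_zero {t : ι} (ht : t ∉ F.I) (hpt : pvec β t ≠ 0) (j : ↥F.I)
    (h : F.N2 t (F.xd hI j) ≠ 0) : ∃ a : k, pvec β j = a • pvec β t := by
  have hrel := F.f_xd_smul_pvec hI ht j
  by_cases hf : β.f t (F.xd hI j) = 0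
  · exfalso
    rw [hf, zero_smul] at hrel
    have hb : F.b t j = 0 := by
      rcases smul_eq_zero.1 hrel.symm with hb | hp
      · exact hb
      · exact absurd hp (F.pvec_ne_zero j.2)
    apply h
    rw [F.N2_xd hI t j, hf, hb, zero_smul, zero_smul, sub_zero]
  · have hb : F.b t j ≠ 0 := by
      intro hb
      rw [hb, zero_smul] at hrel
      rcases smul_eq_zero.1 hrel with h1 | h2
      · exact hf h1
      · exact hpt h2
    refine ⟨(F.b t j)⁻¹ * β.f t (F.xd hI j), ?_⟩
    rw [mul_smul, hrel, smul_smul, inv_mul_cancel₀ hb, one_smul]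

/-- **Lemma 9**: a combination `Q = ∑ c_i P_i` vanishing at all `x_j` with `p_j ∦ δ` is zero
(its values lie on the line `k δ`, but `Q(E_{i1}) = c_i e_1`, `Q(E_{i2}) = c_i e_2`).
[cite: Alekseev2015ChebyshevM22, Lemma 9] -/
theorem eq_zero_of_vanish (δ : Fin 2 → k) (c : Fin m → k)
    (h : ∀ j : ↥F.I, (¬ ∃ a : k, pvec β j = a • δ) → (∑ i, c i • rowMap k m i) (F.xd hI j) = 0) :
    c = 0 := by
  set Q : Blk k m := ∑ i, c i • rowMap k m i with hQ
  have hline : ∀ x, Q x ∈ Submodule.span k ({δ} : Set (Fin 2 → k)) := by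
    refine F.map_mem_of_xd_mem hI Q _ fun j => ?_
    by_cases hpar : ∃ a : k, pvec β j = a • δ
    · obtain ⟨a, ha⟩ := hpar
      rw [hQ, F.sum_rowMap_xd hI c j, ha, smul_smul]
      exact Submodule.smul_mem _ _ (Submodule.mem_span_singleton_self δ)
    · rw [h j hpar]
      exact Submodule.zero_mem _
  have hval : ∀ (i0 : Fin m) (c0 c' : Fin 2),
      Q (Matrix.single i0 c0 1) c' = if c' = c0 then c i0 else 0 := by
    intro i0 c0 c'
    simp only [hQ, LinearMap.coe_sum, Finset.sum_apply, LinearMap.smul_apply, rowMap_apply,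
      Pi.smul_apply, smul_eq_mul, Matrix.single_apply]
    rw [Finset.sum_eq_single i0]
    · by_cases hc : c' = c0
      · simp [hc]
      · rw [if_neg hc, if_neg (fun hh => hc hh.2.symm), mul_zero]
    · intro i _ hi
      rw [if_neg (fun hh => hi hh.1.symm), mul_zero]
    · simp
  funext i0
  by_contra hci
  obtain ⟨a0, ha0⟩ := Submodule.mem_span_singleton.1 (hline (Matrix.single i0 0 1))
  obtain ⟨a1, ha1⟩ := Submodule.mem_span_singleton.1 (hline (Matrix.single i0 1 1))
  have e00 := congrFun ha0 0
  have e01 := congrFun ha0 1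
  have e11 := congrFun ha1 1
  simp only [Pi.smul_apply, smul_eq_mul, hval] at e00 e01 e11
  simp only [if_true] at e00 e11
  rw [if_neg (by decide)] at e01
  have ha0' : a0 ≠ 0 := by rintro rfl; exact hci (by rw [← e00, zero_mul]; rfl)
  have hδ1 : δ 1 ≠ 0 := by rintro h0; exact hci (by rw [← e11, h0, mul_zero]; rfl)
  exact (mul_ne_zero ha0' hδ1) e01

include hI in
/-- **Lemma 11** (at parameters `(2m, ≤ m+1)`): two distinct indices `t₁ ≠ t₂` outside `I` of
"type G" (non-zero `p`) cannot belong to the same class of rows — the `m` independent matrices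
`P_i`, restricted to the rows of the other classes, would lie in the span of `|J| − 2 ≤ m − 1`
matrices. [cite: Alekseev2015ChebyshevM22, Lemma 11] -/
theorem false_of_sameClass (hJ : F.J.card ≤ m + 1) {t1 t2 : ι} (h1 : t1 ∈ F.J) (h2 : t2 ∈ F.J)
    (hne : t1 ≠ t2) (hp1 : pvec β t1 ≠ 0) (hp2 : pvec β t2 ≠ 0)
    (hpar : ∃ a : k, pvec β t2 = a • pvec β t1) : False := by
  classical
  obtain ⟨a12, ha12⟩ := hpar
  have ha12ne : a12 ≠ 0 := by rintro rfl; exact hp2 (by rw [ha12, zero_smul])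
  -- the rows of the other classes
  let U : Submodule k (Matrix (Fin m) (Fin 2) k) :=
    Submodule.span k (Set.range fun j : {j : ↥F.I // ¬ ∃ a : k, pvec β j = a • pvec β t1} =>
      F.xd hI j.1)
  let Res : Blk k m →ₗ[k] (↥U →ₗ[k] (Fin 2 → k)) := LinearMap.lcomp k (Fin 2 → k) U.subtype
  have hRes : ∀ (N : Blk k m), (∀ j : ↥F.I, (¬ ∃ a : k, pvec β j = a • pvec β t1) →
      N (F.xd hI j) = 0) → Res N = 0 := by
    intro N hN
    apply LinearMap.ext
    intro u
    have hU : U ≤ LinearMap.ker N := by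
      refine Submodule.span_le.mpr ?_
      rintro _ ⟨j, rfl⟩
      exact hN j.1 j.2
    simpa [Res] using hU u.2
  have hR1 : Res (F.N2 t1) = 0 :=
    hRes _ fun j hj => by_contra fun hne0 => hj (F.par_of_N2_xd_ne_zero hI (F.mem_J.1 h1) hp1 j hne0)
  have hR2 : Res (F.N2 t2) = 0 := by
    refine hRes _ fun j hj => by_contra fun hne0 => hj ?_
    obtain ⟨a, ha⟩ := F.par_of_N2_xd_ne_zero hI (F.mem_J.1 h2) hp2 j hne0
    exact ⟨a * a12, by rw [ha, ha12, smul_smul]⟩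
  -- the restricted P_i lie in the span of |J| - 2 restricted N's
  let K : Finset ι := F.J \ {t1, t2}
  have hsub : ({t1, t2} : Finset ι) ⊆ F.J := by
    intro t ht
    rcases Finset.mem_insert.1 ht with rfl | ht
    · exact h1
    · rwa [Finset.mem_singleton.1 ht]
  have hJ2 : 2 ≤ F.J.card := by
    have := Finset.card_le_card hsub
    rwa [Finset.card_pair hne] at this
  have hKcard : K.card = F.J.card - 2 := by
    rw [Finset.card_sdiff_of_subset hsub, Finset.card_pair hne]
  have hmem : ∀ i, Res (rowMap k m i) ∈
      Submodule.span k (↑(K.image fun t => Res (F.N2 t)) : Set (↥U →ₗ[k] (Fin 2 → k))) := by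
    intro i
    rw [F.rowMap_eq_sum_N2 i, map_sum]
    refine Submodule.sum_mem _ fun t ht => ?_
    rw [map_smul]
    refine Submodule.smul_mem _ _ ?_
    by_cases hK : t ∈ K
    · exact Submodule.subset_span (by
        rw [Finset.coe_image]
        exact ⟨t, by simpa using hK, rfl⟩)
    · have hor : t = t1 ∨ t = t2 := by
        by_contra hh
        obtain ⟨h1', h2'⟩ := not_or.mp hh
        exact hK (Finset.mem_sdiff.2 ⟨ht, by simp [h1', h2']⟩)
      rcases hor with rfl | rfl
      · rw [hR1]; exact Submodule.zero_mem _
      · rw [hR2]; exact Submodule.zero_mem _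
  -- the restricted P_i are independent (Lemma 9)
  have hli : LinearIndependent k fun i => Res (rowMap k m i) := by
    rw [Fintype.linearIndependent_iff]
    intro c hc
    have hc' : Res (∑ i, c i • rowMap k m i) = 0 := by
      rw [map_sum]
      simpa [map_smul] using hc
    have hzero := F.eq_zero_of_vanish hI (pvec β t1) c fun j hj => by
      have hxU : F.xd hI j ∈ U := Submodule.subset_span ⟨⟨j, hj⟩, rfl⟩
      have := LinearMap.congr_fun hc' ⟨F.xd hI j, hxU⟩
      simpa [Res] using this
    exact fun i => congrFun hzero i
  have hdim1 : finrank k (Submodule.span k (Set.range fun i => Res (rowMap k m i))) = m := by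
    rw [finrank_span_eq_card hli, Fintype.card_fin]
  have hdim2 : finrank k (Submodule.span k (Set.range fun i => Res (rowMap k m i))) ≤
      finrank k (Submodule.span k
        (↑(K.image fun t => Res (F.N2 t)) : Set (↥U →ₗ[k] (Fin 2 → k)))) := by
    apply Submodule.finrank_mono
    refine Submodule.span_le.mpr ?_
    rintro _ ⟨i, rfl⟩
    exact hmem i
  have hdim3 : finrank k (Submodule.span k
      (↑(K.image fun t => Res (F.N2 t)) : Set (↥U →ₗ[k] (Fin 2 → k)))) ≤
      (K.image fun t => Res (F.N2 t)).card :=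
    finrank_span_finset_le_card (R := k) (K.image fun t => Res (F.N2 t))
  have hdim4 : (K.image fun t => Res (F.N2 t)).card ≤ K.card := Finset.card_image_le
  rw [hdim1] at hdim2
  omega

/-- The rank-two indices (`J ∖ R1`) have non-zero `p_t` (a vanishing `p_t` makes `D_t^1 = 0`,
type F, rank one). [cite: Alekseev2015ChebyshevM22, Lemma 10] -/
theorem pvec_ne_zero_of_not_mem_R1 {t : ι} (ht : t ∈ F.J) (hR : t ∉ F.R1) : pvec β t ≠ 0 := by
  intro h0
  apply hR
  rw [F.mem_R1]
  refine ⟨ht, ?_⟩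
  have hD : D1 β t = 0 := by ext x; simp [h0]
  rw [F.N2_eq_D2_of_D1_eq_zero (F.mem_J.1 ht) hD]
  exact rankLEOne_smulRight _ _

include hI in
/-- **Lemma 7 (at parameters `(2m, m+1)`): there is no solution with `l = 2m`** (and `|J| ≤ m+1`).
The count of rank-one `N_t` gives `s ≤ 2`; a non-zero `Q = ∑ c_i P_i` in the span of the rank-two
`N_t` exists (`m − s ≥ 1`); writing `Q = ∑ λ_t N_t^2`, a `t₀` with `λ_{t₀} ≠ 0` has all
`N_{t₀}^2(x_j)` on the line `k p_{t₀}` (the other rank-two `N_t` vanish on the class of `t₀` by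
Lemmas 10–11, and `Q(x_j) ∈ k p_j` by Lemma 8), so `N_{t₀}^2` has rank one — a contradiction.
[cite: Alekseev2015ChebyshevM22, Lemma 7] -/
theorem stepD (hm : 3 ≤ m) (hJ : F.J.card ≤ m + 1) : False := by
  classical
  -- s ≤ 2
  have hcol := F.colCount
  have hsd : (F.J \ F.R1).card = F.J.card - F.R1.card := Finset.card_sdiff_of_subset F.R1_subset
  have hR1le : F.R1.card ≤ F.J.card := Finset.card_le_card F.R1_subset
  have hR1 : F.R1.card ≤ 2 := by omega
  -- the spaces
  let R2 : Finset ι := F.J \ F.R1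
  let SS : Submodule k (Blk k m) := Submodule.span k (Set.range (rowMap k m))
  let C : Submodule k (Blk k m) := Submodule.span k (Set.range fun t : ↥R2 => F.N2 t)
  let B1 : Submodule k (Blk k m) := Submodule.span k (↑(F.R1.image F.N2) : Set (Blk k m))
  have hSS : finrank k SS = m := by
    simp only [SS]
    rw [finrank_span_eq_card (linearIndependent_rowMap (k := k) (m := m)), Fintype.card_fin]
  have hB1 : finrank k B1 ≤ 2 :=
    ((finrank_span_finset_le_card (R := k) (F.R1.image F.N2)).trans Finset.card_image_le).trans hR1
  have hle : SS ≤ B1 ⊔ C := by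
    refine Submodule.span_le.mpr ?_
    rintro _ ⟨i, rfl⟩
    rw [F.rowMap_eq_sum_N2 i]
    refine Submodule.sum_mem _ fun t ht => Submodule.smul_mem _ _ ?_
    by_cases hR : t ∈ F.R1
    · refine Submodule.mem_sup_left (Submodule.subset_span ?_)
      rw [Finset.coe_image]
      exact ⟨t, by simpa using hR, rfl⟩
    · refine Submodule.mem_sup_right (Submodule.subset_span ?_)
      exact ⟨⟨t, Finset.mem_sdiff.2 ⟨ht, hR⟩⟩, rfl⟩
  have hdim : m ≤ finrank k ↥(SS ⊓ C) + 2 := by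
    have h1 := Submodule.finrank_sup_add_finrank_inf_eq SS C
    have h2 : finrank k ↥(SS ⊔ C) ≤ finrank k ↥(B1 ⊔ C) :=
      Submodule.finrank_mono (sup_le hle le_sup_right)
    have h3 := Submodule.finrank_add_le_finrank_add_finrank B1 C
    omega
  have hne : SS ⊓ C ≠ ⊥ := by
    intro hbot
    rw [hbot, finrank_bot] at hdim
    omega
  obtain ⟨Q, hQmem, hQne⟩ := Submodule.exists_mem_ne_zero_of_ne_bot hne
  obtain ⟨c, hc⟩ := (Submodule.mem_span_range_iff_exists_fun k).1 (Submodule.mem_inf.1 hQmem).1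
  obtain ⟨lam, hlam⟩ := (Submodule.mem_span_range_iff_exists_fun k).1 (Submodule.mem_inf.1 hQmem).2
  -- a t0 with λ ≠ 0
  obtain ⟨t0, ht0⟩ : ∃ t0 : ↥R2, lam t0 ≠ 0 := by
    by_contra hall
    apply hQne
    rw [← hlam]
    refine Finset.sum_eq_zero fun t _ => ?_
    rw [show lam t = 0 from not_not.mp (fun h => hall ⟨t, h⟩), zero_smul]
  have hR2J : ∀ t : ↥R2, (t : ι) ∈ F.J := fun t => (Finset.mem_sdiff.1 t.2).1
  have hR2I : ∀ t : ↥R2, (t : ι) ∉ F.I := fun t => F.mem_J.1 (hR2J t)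
  have hR2R : ∀ t : ↥R2, (t : ι) ∉ F.R1 := fun t => (Finset.mem_sdiff.1 t.2).2
  have hR2p : ∀ t : ↥R2, pvec β t ≠ 0 := fun t => F.pvec_ne_zero_of_not_mem_R1 (hR2J t) (hR2R t)
  -- all values N2 t0 (x_j) lie on the line k p_{t0}
  have hlineJ : ∀ j : ↥F.I, F.N2 t0 (F.xd hI j) ∈
      Submodule.span k ({pvec β t0} : Set (Fin 2 → k)) := by
    intro j
    by_cases hpar : ∃ a : k, pvec β j = a • pvec β t0
    · -- the other rank-two N_t vanish at x_j
      have hvan : ∀ t : ↥R2, t ≠ t0 → F.N2 t (F.xd hI j) = 0 := by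
        intro t htne
        by_contra hne0
        obtain ⟨a, ha⟩ := F.par_of_N2_xd_ne_zero hI (hR2I t) (hR2p t) j hne0
        obtain ⟨a', ha'⟩ := hpar
        -- p_t and p_{t0} are proportional: same class, contradiction with Lemma 11
        have hane : a ≠ 0 := by
          rintro rfl; exact F.pvec_ne_zero j.2 (by rw [ha, zero_smul])
        refine F.false_of_sameClass hI hJ (hR2J t0) (hR2J t) (fun h => htne (Subtype.ext h.symm))
          (hR2p t0) (hR2p t) ⟨a⁻¹ * a', ?_⟩
        rw [mul_smul, ← ha', ha, smul_smul, inv_mul_cancel₀ hane, one_smul]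
      have hQj : Q (F.xd hI j) = lam t0 • F.N2 t0 (F.xd hI j) := by
        rw [← hlam, LinearMap.coe_sum, Finset.sum_apply, Finset.sum_eq_single t0]
        · rfl
        · intro t _ htne
          rw [LinearMap.smul_apply, hvan t htne, smul_zero]
        · simp
      have hQj' : Q (F.xd hI j) = (∑ i, c i * F.κ i j) • pvec β j := by
        rw [← hc, F.sum_rowMap_xd hI c j]
      obtain ⟨a', ha'⟩ := hpar
      have : F.N2 t0 (F.xd hI j) = ((lam t0)⁻¹ * ((∑ i, c i * F.κ i j) * a')) • pvec β t0 := by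
        rw [mul_smul, ← smul_smul, ← ha', ← hQj', hQj, smul_smul, inv_mul_cancel₀ ht0, one_smul]
      rw [this]
      exact Submodule.smul_mem _ _ (Submodule.mem_span_singleton_self _)
    · have : F.N2 t0 (F.xd hI j) = 0 := by
        by_contra hne0
        exact hpar (F.par_of_N2_xd_ne_zero hI (hR2I t0) (hR2p t0) j hne0)
      rw [this]
      exact Submodule.zero_mem _
  have hrk : RankLEOne (F.N2 t0) :=
    rankLEOne_of_forall_mem_span _ _ (F.map_mem_of_xd_mem hI _ _ hlineJ)
  exact hR2R t0 (F.mem_R1.2 ⟨hR2J t0, hrk⟩)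

end StepD


/-! ## The case `l = 2m + 1` (Lemma 12) -/

section StepE

/-- `(D_t^1)_{t ∈ I}` has no zero member. [cite: Alekseev2015ChebyshevM22, §3 (2)] -/
theorem D1_ne_zero_of_mem {t : ι} (ht : t ∈ F.I) : D1 β t ≠ 0 := by
  intro h1
  have := F.indep (fun p => if p = t then 1 else 0) (by simp [Finset.sum_ite_eq', ht, h1]) t ht
  simp at this

/-- **The parameters are forced** (Lemma 6 with Lemma 7): a computation of length `≤ 3m + 1` has
`l = 2m + 1` and `d − l = m` (and length exactly `3m + 1`). [cite: Alekseev2015ChebyshevM22, Lemma 6, Lemma 7, proof of Thm 1 (p. 24)] -/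
theorem card_eq (hm : 3 ≤ m) (hι : Fintype.card ι ≤ 3 * m + 1) :
    F.I.card = 2 * m + 1 ∧ F.J.card = m := by
  have h1 := F.two_mul_le_card
  have h2 := F.le_card_J
  have h3 := F.card_I_add_card_J
  by_cases hI : F.I.card = 2 * m
  · exact (F.stepD hI hm (by omega)).elim
  · omega

/-- A sum over `ι` of terms supported on `I`. [folklore] -/
private theorem sum_ite_mem_smul (e : ι → k) (D : ι → Blk k m) :
    ∑ t, (if t ∈ F.I then e t else 0) • D t = ∑ p ∈ F.I, e p • D p := by
  have : ∀ t, (if t ∈ F.I then e t else 0) • D t = if t ∈ F.I then e t • D t else 0 := by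
    intro t; split_ifs <;> simp
  simp_rw [this]
  rw [Finset.sum_ite_mem, Finset.univ_inter]

/-- **(7) of the source**: `R_i := ∑_{p ∈ I} κ_i^p D_p^2` lies in the span of the `N_t^2`, `t ∉ I`
(the matrix `P_{i1} − ∑_t k_i^t D_t` has zero first block, so Lemma 5 applies).
[cite: Alekseev2015ChebyshevM22, Lemma 12 (proof, (7))] -/
theorem R_mem_span_N2 (i : Fin m) :
    ∑ p ∈ F.I, F.κ i p • D2 β p ∈ Submodule.span k (F.N2 '' (F.J : Set ι)) := by
  have h1 : ∑ t, (β.w t i 0 - if t ∈ F.I then F.κ i t else 0) • D1 β t = 0 := by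
    rw [Finset.sum_congr rfl (fun t _ =>
      sub_smul (β.w t i 0) (if t ∈ F.I then F.κ i t else 0) (D1 β t)), Finset.sum_sub_distrib,
      F.sum_ite_mem_smul, E1, ← F.rowMap_eq_sum_κ, sub_self]
  have h2 := F.sum_D2_eq_sum_N2 (fun t => β.w t i 0 - if t ∈ F.I then F.κ i t else 0) h1
  beta_reduce at h2
  have h3 : ∑ t, (β.w t i 0 - if t ∈ F.I then F.κ i t else 0) • D2 β t =
      -∑ p ∈ F.I, F.κ i p • D2 β p := by
    rw [Finset.sum_congr rfl (fun t _ =>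
      sub_smul (β.w t i 0) (if t ∈ F.I then F.κ i t else 0) (D2 β t)), Finset.sum_sub_distrib,
      F.sum_ite_mem_smul, E2, zero_sub]
  have hmem : ∑ t, (β.w t i 0 - if t ∈ F.I then F.κ i t else 0) • D2 β t ∈
      Submodule.span k (F.N2 '' (F.J : Set ι)) := by
    rw [h2]
    exact Submodule.sum_mem _ fun t ht =>
      Submodule.smul_mem _ _ (Submodule.subset_span ⟨t, by simpa using ht, rfl⟩)
  rw [h3] at hmem
  simpa using Submodule.neg_mem _ hmem

/-- **(6) of the source**: when `d − l ≤ m` the `N_t^2`, `t ∉ I`, span exactly the span of the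
`P_i`. [cite: Alekseev2015ChebyshevM22, Lemma 12 (proof, (6))] -/
theorem span_N2_eq (hJ : F.J.card ≤ m) :
    Submodule.span k (F.N2 '' (F.J : Set ι)) = Submodule.span k (Set.range (rowMap k m)) := by
  classical
  symm
  apply Submodule.eq_of_le_of_finrank_le
  · exact Submodule.span_le.mpr (by rintro _ ⟨i, rfl⟩; exact F.rowMap_mem_span_N2 i)
  · rw [finrank_span_eq_card (linearIndependent_rowMap (k := k) (m := m)), Fintype.card_fin]
    have h1 : finrank k (Submodule.span k (↑(F.J.image F.N2) : Set (Blk k m))) ≤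
        (F.J.image F.N2).card := finrank_span_finset_le_card (R := k) _
    rw [Finset.coe_image] at h1
    exact h1.trans (Finset.card_image_le.trans hJ)

/-- A maximal linearly independent subfamily of `(f_t)_{t ∈ I}`: `2m` indices `I' ⊆ I` with the
`f_t`, `t ∈ I'`, linearly independent ("построены на `2m` линейно независимых столбцах").
[cite: Alekseev2015ChebyshevM22, Lemma 12 (proof)] -/
theorem exists_indep_sub : ∃ I' : Finset ι, I' ⊆ F.I ∧ I'.card = 2 * m ∧
    ∀ c : ι → k, ∑ p ∈ I', c p • β.f p = 0 → ∀ p ∈ I', c p = 0 := by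
  classical
  let v : ι → Module.Dual k (Matrix (Fin m) (Fin 2) k) := fun t => if t ∈ F.I then β.f t else 0
  obtain ⟨s, hli, hmax⟩ := exists_maximal_linearIndepOn k v
  have hsI : ∀ t ∈ s, t ∈ F.I := by
    intro t ht
    by_contra htI
    have := hli.ne_zero ht
    simp [v, htI] at this
  have hvs : ∀ t ∈ s, v t = β.f t := fun t ht => by simp [v, hsI t ht]
  have hspan : Submodule.span k (v '' s) = ⊤ := by
    rw [eq_top_iff, ← F.span_f_eq_top, Submodule.span_le]
    rintro _ ⟨t, ht, rfl⟩
    have ht' : t ∈ F.I := by simpa using ht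
    by_cases hts : t ∈ s
    · rw [← hvs t hts]
      exact Submodule.subset_span ⟨t, hts, rfl⟩
    · obtain ⟨a, ha, hat⟩ := hmax t hts
      have := Submodule.smul_mem _ a⁻¹ hat
      rw [smul_smul, inv_mul_cancel₀ ha, one_smul] at this
      simpa [v, ht'] using this
  let I' : Finset ι := s.toFinset
  have hI's : (I' : Set ι) = s := by simp [I']
  refine ⟨I', fun t ht => hsI t (by simpa [I'] using ht), ?_, ?_⟩
  · have hli' := hli.linearIndependent
    have hcard := finrank_span_eq_card hli'
    have hrange : Set.range (fun x : ↥s => v x) = v '' s := by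
      ext φ; simp
    rw [hrange, hspan, finrank_top, finrank_dual] at hcard
    rw [show I'.card = Fintype.card ↥s from by simp [I', Set.toFinset_card]]
    exact hcard.symm
  · intro c hc p hp
    have hps : p ∈ s := by simpa [I'] using hp
    have hc' : ∑ t ∈ I', c t • v t = 0 := by
      rw [← hc]
      exact Finset.sum_congr rfl fun t ht => by rw [hvs t (by simpa [I'] using ht)]
    exact (linearIndepOn_iff'.1 hli) I' c (by rw [hI's]) hc' p hp

end StepE

end Frame

/-! ## Lemma 12 and Theorem 1 -/

section Main

variable [DecidableEq ι]

/-- **Every first block is non-zero** in a computation of length `≤ 3m + 1` (`m ≥ 3`): a vanishing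
`D_t^1` makes `t ∉ I` and `N_t = D_t` of rank one, but with `d − l = m` the column count leaves no
room for a rank-one `N_t` (the last step of the proof of Lemma 12).
[cite: Alekseev2015ChebyshevM22, Lemma 12 (proof, last paragraph)] -/
theorem D1_ne_zero (β : BilinComp (mulBilin k m 2 2) ι) (hm : 3 ≤ m)
    (hι : Fintype.card ι ≤ 3 * m + 1) (t : ι) : D1 β t ≠ 0 := by
  classical
  obtain ⟨F⟩ := exists_frame β
  obtain ⟨_, hJ⟩ := F.card_eq hm hι
  intro h0
  have htI : t ∉ F.I := fun ht => F.D1_ne_zero_of_mem ht h0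
  have htR : t ∈ F.R1 := by
    rw [F.mem_R1]
    refine ⟨F.mem_J.2 htI, ?_⟩
    rw [F.N2_eq_D2_of_D1_eq_zero htI h0]
    exact rankLEOne_smulRight _ _
  have hcol := F.colCount
  have hsd : (F.J \ F.R1).card = F.J.card - F.R1.card := Finset.card_sdiff_of_subset F.R1_subset
  have hR1le : F.R1.card ≤ F.J.card := Finset.card_le_card F.R1_subset
  have hpos : 0 < F.R1.card := Finset.card_pos.2 ⟨t, htR⟩
  omega

/-- The matrix units times `v'`: `E_{j1} v' = v'_{11} E_{j1} + v'_{12} E_{j2}`. [folklore] -/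
private theorem single_mul_two (j : Fin 2) (v' : Matrix (Fin 2) (Fin 2) k) :
    Matrix.single j 0 (1 : k) * v' = v' 0 0 • Matrix.single j 0 1 + v' 0 1 • Matrix.single j 1 1 := by
  ext a b
  rw [Matrix.add_apply, Matrix.smul_apply, Matrix.smul_apply]
  by_cases ha : a = j
  · subst ha
    rw [Matrix.single_mul_apply_same]
    fin_cases b <;> simp
  · rw [Matrix.single_mul_apply_of_ne (1 : k) j 0 a b ha,
      Matrix.single_apply_of_row_ne (Ne.symm ha), Matrix.single_apply_of_row_ne (Ne.symm ha)]
    simp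

/-- **Lemma 12 / Theorem 1 for computations**: every bilinear computation of `⟨m,2,2⟩`, `m ≥ 3`,
has length at least `3m + 2`. [cite: Alekseev2015ChebyshevM22, Thm 1, Lemma 12] -/
theorem card_ge (β : BilinComp (mulBilin k m 2 2) ι) (hm : 3 ≤ m) : 3 * m + 2 ≤ Fintype.card ι := by
  classical
  by_contra hlt
  have hι : Fintype.card ι ≤ 3 * m + 1 := by omega
  obtain ⟨F⟩ := exists_frame β
  obtain ⟨hI, hJ⟩ := F.card_eq hm hι
  -- (6): the N_t span exactly the span of the P_i
  have h6 := F.span_N2_eq hJ.le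
  -- I' and ℓ₀
  obtain ⟨I', hI'I, hI'card, hI'indep⟩ := F.exists_indep_sub
  obtain ⟨l0, hl0⟩ : ∃ l0, F.I \ I' = {l0} := by
    apply Finset.card_eq_one.1
    rw [Finset.card_sdiff_of_subset hI'I]
    omega
  have hl0I : l0 ∈ F.I := (Finset.mem_sdiff.1 (by rw [hl0]; exact Finset.mem_singleton_self l0)).1
  have hl0I' : l0 ∉ I' := (Finset.mem_sdiff.1 (by rw [hl0]; exact Finset.mem_singleton_self l0)).2
  have hsplit : ∀ (g : ι → Blk k m), ∑ p ∈ F.I, g p = g l0 + ∑ p ∈ I', g p := by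
    intro g
    rw [← Finset.sum_sdiff hI'I, hl0, Finset.sum_singleton]
  -- (7): R_i := ∑_p κ_i^p D_p^2 ∈ span P; its coefficients r i
  have hRmem : ∀ i, ∑ p ∈ F.I, F.κ i p • D2 β p ∈ Submodule.span k (Set.range (rowMap k m)) := by
    intro i; rw [← h6]; exact F.R_mem_span_N2 i
  choose r hr using fun i => (Submodule.mem_span_range_iff_exists_fun k).1 (hRmem i)
  -- the two linear conditions on c (the source's (5) and the choice of `v₃`)
  let Λ1 : (Fin m → k) →ₗ[k] k :=
    { toFun := fun c => ∑ i, c i * F.κ i l0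
      map_add' := fun c c' => by simp [add_mul, Finset.sum_add_distrib]
      map_smul' := fun a c => by simp [Finset.mul_sum, mul_assoc] }
  let Λ2 : (Fin m → k) →ₗ[k] k :=
    { toFun := fun c => ∑ j, ∑ i, c i * r i j * F.κ j l0
      map_add' := fun c c' => by
        simp only [Pi.add_apply, add_mul, Finset.sum_add_distrib]
      map_smul' := fun a c => by
        simp only [Pi.smul_apply, smul_eq_mul, RingHom.id_apply, Finset.mul_sum, mul_assoc] }
  let Λ : (Fin m → k) →ₗ[k] k × k := Λ1.prod Λ2
  have hker : LinearMap.ker Λ ≠ ⊥ := by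
    intro hbot
    have h1 := Λ.finrank_range_add_finrank_ker
    rw [hbot, finrank_bot, add_zero] at h1
    have h2 : finrank k (LinearMap.range Λ) ≤ finrank k (k × k) := Submodule.finrank_le _
    rw [Module.finrank_prod, Module.finrank_self, h1, Module.finrank_pi k, Fintype.card_fin] at h2
    omega
  obtain ⟨c, hcker, hc0⟩ := Submodule.exists_mem_ne_zero_of_ne_bot hker
  have hΛ1 : ∑ i, c i * F.κ i l0 = 0 := by
    have := LinearMap.mem_ker.1 hcker
    simpa [Λ, Λ1] using congrArg Prod.fst this
  have hΛ2 : ∑ j, (∑ i, c i * r i j) * F.κ j l0 = 0 := by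
    have := LinearMap.mem_ker.1 hcker
    have h' : ∑ j, ∑ i, c i * r i j * F.κ j l0 = 0 := by
      simpa [Λ, Λ2] using congrArg Prod.snd this
    rw [← h']
    exact Finset.sum_congr rfl fun j _ => Finset.sum_mul _ _ _
  -- Q = ∑ c_i P_i and its two expansions
  set κc : ι → k := fun p => ∑ i, c i * F.κ i p with hκc
  have hQ : ∑ i, c i • rowMap k m i = ∑ p ∈ I', κc p • D1 β p := by
    have : ∑ i, c i • rowMap k m i = ∑ p ∈ F.I, κc p • D1 β p := by
      simp only [hκc, Finset.sum_smul, mul_smul]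
      rw [Finset.sum_comm]
      exact Finset.sum_congr rfl fun i _ => by rw [F.rowMap_eq_sum_κ i, Finset.smul_sum]
    rw [this, hsplit, show κc l0 = 0 from hΛ1, zero_smul, zero_add]
  set rc : Fin m → k := fun j => ∑ i, c i * r i j with hrc
  set hh : ι → k := fun p => ∑ j, rc j * F.κ j p with hhh
  have hR : ∑ p ∈ I', κc p • D2 β p = ∑ p ∈ I', hh p • D1 β p := by
    have e1 : ∑ p ∈ F.I, κc p • D2 β p = ∑ j, rc j • rowMap k m j := by
      calc ∑ p ∈ F.I, κc p • D2 β p = ∑ i, c i • ∑ p ∈ F.I, F.κ i p • D2 β p := by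
            simp only [hκc, Finset.sum_smul, mul_smul, Finset.smul_sum]
            rw [Finset.sum_comm]
        _ = ∑ i, c i • ∑ j, r i j • rowMap k m j := by
            refine Finset.sum_congr rfl fun i _ => ?_
            rw [hr i]
        _ = ∑ j, rc j • rowMap k m j := by
            simp only [hrc, Finset.sum_smul, mul_smul, Finset.smul_sum]
            rw [Finset.sum_comm]
    have e2 : ∑ j, rc j • rowMap k m j = ∑ p ∈ F.I, hh p • D1 β p := by
      simp only [hhh, Finset.sum_smul, mul_smul]
      rw [Finset.sum_comm]
      exact Finset.sum_congr rfl fun j _ => by rw [F.rowMap_eq_sum_κ j, Finset.smul_sum]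
    have e3 : ∑ p ∈ F.I, κc p • D2 β p = ∑ p ∈ I', κc p • D2 β p := by
      rw [hsplit, show κc l0 = 0 from hΛ1, zero_smul, zero_add]
    have e4 : ∑ p ∈ F.I, hh p • D1 β p = ∑ p ∈ I', hh p • D1 β p := by
      rw [hsplit, show hh l0 = 0 from hΛ2, zero_smul, zero_add]
    rw [← e3, e1, e2, e4]
  -- termwise: κc p • q_p = hh p • p_p for p ∈ I'
  have hterm : ∀ p ∈ I', κc p • qvec β p = hh p • pvec β p := by
    have hcol : ∀ c' : Fin 2, ∑ p ∈ I', (κc p * qvec β p c' - hh p * pvec β p c') • β.f p = 0 := by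
      intro c'
      have := congrArg (col c') (sub_eq_zero.2 hR)
      rw [map_zero, map_sub, map_sum, map_sum, ← Finset.sum_sub_distrib] at this
      rw [← this]
      refine Finset.sum_congr rfl fun p _ => ?_
      ext x
      simp only [LinearMap.smul_apply, LinearMap.sub_apply, map_smul, col_apply, D1_apply, D2_apply,
        Pi.smul_apply, smul_eq_mul]
      ring
    intro p hp
    funext c'
    have := hI'indep _ (hcol c') p hp
    simp only [Pi.smul_apply, smul_eq_mul]
    exact sub_eq_zero.1 this
  -- some κc p0 ≠ 0
  obtain ⟨p0, hp0, hκ0⟩ : ∃ p0 ∈ I', κc p0 ≠ 0 := by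
    by_contra hall
    apply hc0
    have hQ0 : ∑ i, c i • rowMap k m i = 0 := by
      rw [hQ]
      refine Finset.sum_eq_zero fun p hp => ?_
      rw [show κc p = 0 from not_not.mp (fun h => hall ⟨p, hp, h⟩), zero_smul]
    funext i
    exact (Fintype.linearIndependent_iff.1 (linearIndependent_rowMap (k := k) (m := m)) c hQ0) i
  -- Lemma 4: change the column split so that the new p_{p0} vanishes
  set κ0 := κc p0 with hκ0def
  set h0 := hh p0 with hh0def
  let v' : Matrix (Fin 2) (Fin 2) k := !![-h0, κ0; 1, 0]
  let v : Matrix (Fin 2) (Fin 2) k := !![0, 1; κ0⁻¹, h0 * κ0⁻¹]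
  have hv : v' * v = 1 := by
    ext a b
    fin_cases a <;> fin_cases b <;> simp [v, v', Matrix.mul_apply, Fin.sum_univ_two, hκ0]
    all_goals (try field_simp)
    all_goals ring
  let β' : BilinComp (mulBilin k m 2 2) ι :=
    β.sandwich 1 1 v v' (Matrix.mul_one 1) hv
  have hp' : pvec β' p0 = 0 := by
    funext j
    simp only [pvec, Pi.zero_apply]
    rw [BilinComp.sandwich_g, single_mul_two, map_add, map_smul, map_smul]
    have e := congrFun (hterm p0 hp0) j
    simp only [Pi.smul_apply, smul_eq_mul] at e
    simp only [v', Matrix.of_apply, Matrix.cons_val', Matrix.cons_val_zero, Matrix.cons_val_one,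
      Matrix.empty_val', Matrix.cons_val_fin_one, smul_eq_mul, pvec, qvec] at e ⊢
    linear_combination e
  have hD : D1 β' p0 = 0 := by
    ext x
    simp [hp']
  exact D1_ne_zero β' hm hι p0 hD

end Main

end Alekseev2015

/-! ## The rank statements -/

/-- **Alekseev 2015, Theorem 1, for the rank**: `3m + 2 ≤ R(⟨m,2,2⟩)` for every field and every
`m ≥ 3`. [cite: Alekseev2015ChebyshevM22, Thm 1] -/
theorem three_mul_add_two_le_tensorRank_matMulTensor_m22 (k : Type*) [Field k] {m : ℕ}
    (hm : 3 ≤ m) : 3 * m + 2 ≤ tensorRank (matMulTensor k m 2 2) := by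
  classical
  obtain ⟨β⟩ := exists_bilinComp_of_tensorRank_le (k := k) (c := m) (m := 2) (n := 2) le_rfl
  simpa [Fintype.card_fin] using Alekseev2015.card_ge β hm

/-- **DISCHARGE of `alekseev2015_rank_matMulTensor_m22_ge`** (Alekseev 2015, Thm 1: for every
field `k` and every `m ≥ 3`, `3m + 2 ≤ R(⟨m,2,2⟩)`). [cite: Alekseev2015ChebyshevM22, Thm 1] -/
theorem alekseev2015_rank_matMulTensor_m22_ge_holds : alekseev2015_rank_matMulTensor_m22_ge :=
  fun k _ _ hm => three_mul_add_two_le_tensorRank_matMulTensor_m22 k hm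

variable (k : Type) [Field k]

/-- **`R(⟨2,2,3⟩) = 11` over every field, unconditionally** (Alekseyev 1985; Alekseev 2015 Thm 1
at `m = 3` and Hopcroft–Kerr 1971). [cite: Alekseyev1985, main theorem (zbMATH 0577.68059)] -/
theorem alekseyev1985_tensorRank_matMulTensor_223' : tensorRank (matMulTensor k 2 2 3) = 11 :=
  alekseyev1985_tensorRank_matMulTensor_223 k alekseev2015_rank_matMulTensor_m22_ge_holds

/-- **`R(⟨3,2,2⟩) = R(⟨2,3,2⟩) = R(⟨2,2,3⟩) = 11` over every field, unconditionally.**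
[cite: Alekseyev1985, main theorem (zbMATH 0577.68059)] -/
theorem alekseyev1985_tensorRank_matMulTensor_322_232_223' :
    tensorRank (matMulTensor k 3 2 2) = 11 ∧ tensorRank (matMulTensor k 2 3 2) = 11 ∧
      tensorRank (matMulTensor k 2 2 3) = 11 :=
  alekseyev1985_tensorRank_matMulTensor_322_232_223 k alekseev2015_rank_matMulTensor_m22_ge_holds

/-- **`R(⟨2,2,4⟩) = 14` over every field, unconditionally** (Alekseev–Smirnov 2013; Alekseev 2015
Thm 1 at `m = 4` and Hopcroft–Kerr 1971). [cite: AlekseevSmirnov2013, Thm 1 (zbMATH 1317.68061)] -/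
theorem alekseevSmirnov2013_tensorRank_matMulTensor_224' : tensorRank (matMulTensor k 2 2 4) = 14 :=
  alekseevSmirnov2013_tensorRank_matMulTensor_224 k alekseev2015_rank_matMulTensor_m22_ge_holds

/-- **`17 ≤ R(⟨2,2,5⟩) ≤ 18` over every field, unconditionally** (Alekseev 2014 / 2015 Thm 1 at
`m = 5`; Hopcroft–Kerr 1971). [cite: Alekseev2015ChebyshevM22, Thm 1 and §4] -/
theorem alekseev2014_tensorRank_matMulTensor_225_mem_Icc' :
    tensorRank (matMulTensor k 2 2 5) ∈ Set.Icc 17 18 :=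
  alekseev2014_tensorRank_matMulTensor_225_mem_Icc k alekseev2015_rank_matMulTensor_m22_ge_holds

/-- `3n + 2 ≤ R(⟨2,2,n⟩) ≤ ⌈7n/2⌉` over every field for `n ≥ 3`, unconditionally
(Alekseev 2015 Thm 1; Hopcroft–Kerr 1971). [cite: Alekseev2015ChebyshevM22, Thm 1 and §4] -/
theorem tensorRank_matMulTensor_22n_mem_Icc' (n : ℕ) (hn : 3 ≤ n) :
    tensorRank (matMulTensor k 2 2 n) ∈ Set.Icc (3 * n + 2) ((7 * n + 1) / 2) :=
  ⟨alekseev2015_rank_matMulTensor_22m_ge k alekseev2015_rank_matMulTensor_m22_ge_holds n hn,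
    hopcroftKerr1971_tensorRank_matMulTensor_22n_le (K := k) n⟩

end Literature.Computability.AlgebraicComplexity
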